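import Mathlib
import Literature.LinearAlgebra.Matrix.GerstenhaberNilpotentSubspace
import Summits.ValiantsHypothesis.ValiantsHypothesis.Theorems.GrenetZeonTwoDimCoefficientsDualUnipotentLevelFlat
import Summits.ValiantsHypothesis.ValiantsHypothesis.Theorems.GrenetZeonTwoDimCoefficientsDualUnipotentTriangularisable
import Summits.ValiantsHypothesis.ValiantsHypothesis.Theorems.GrenetZeonTwoDimCoefficientsDualUnipotentNormalForm
import Summits.ValiantsHypothesis.ValiantsHypothesis.Theorems.GrenetZeonDualUnipotentThreeHalvesHeavyTopCompositionCore
import Summits.ValiantsHypothesis.ValiantsHypothesis.Theorems.GrenetZeonDualUnipotentThreeHalvesHeavyTopCompositionBlocks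
import Summits.ValiantsHypothesis.ValiantsHypothesis.Theorems.GrenetZeonDualUnipotentThreeHalvesHeavyTopCoarseFlag

/-!
# Crux `GrenetZeon.TwoDimCoefficients` (stmt-ValiantsHypothesis-8062), stub `stub_dualUnipotent`:
# the WILD CORE — every unipotent-dual representation of `per_n` of width `m` has a LARGE IRREDUCIBLE
# nilpotent constituent (unconditional; Jordan–Hölder + level flatness + Gerstenhaber inside the blocks)

The located open point of the stub (`CALIBRATION-stub_dualUnipotent.md` v4, census `census-8062-g3.md` §5) is
the class of WILD nilpotent pencils — those with no invariant flag with small quotients.  This file makes that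
location a kernel theorem, by running the tree's Jordan–Hölder layers for a set of matrices
(✓ `HeavyTopCompositionBound.exists_block_conj`: block-triangular conjugate with IRREDUCIBLE diagonal blocks) on
the nilpotent linear space `W = ℂ·N(0) + N_lin(ℂ^{n×n})` of the pencil, and pricing the resulting block form with
the 8062-side level flatness (✓ `finrank_le_of_diagStill`, LEMMA_g) and Gerstenhaber INSIDE each diagonal block
(✓ `Literature…finrank_le_choose_two`):

* `sq_le_of_blockDims` — **block rung, dimension form.**  `per_n = tr(N^d·M)` (`N`, `M` affine), `P·N·P⁻¹` block
  upper triangular for `lvl` with `p` levels (`(P N P⁻¹)ᵢⱼ = 0` for `lvl i < lvl j`, the convention of the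
  24318-side files), and the `t`-th diagonal block space of the conjugated tops of dimension `≤ D t`
  ⟹ `n² ≤ 2·p·n + Σ_{t<p} D t`.  (✓ `sq_le_of_blockUpper` is the case `D t = b_t²`, no conjugation.)
* `finrank_blockSpan_le_choose_two`, `sq_le_of_blockLevels_nil` — for a NILPOTENT pencil (`N^m = 0`) whose space
  `W` is block upper after `P`, Gerstenhaber in each block gives `n² ≤ 2·p·n + Σ_{t<p} C(b_t, 2)`,
  `b_t = #{i : lvl i = t}`.
* `sq_le_of_smallLevels_nil` — **coarse form**: if every level has `≤ s` members (`s ≥ 1`, ANY number of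
  levels) then `n² ≤ 2(m/s + 1)·n + s·m` (coarsen with ✓ `KrylovSeed.coarse_lt_imp / sum_choose_coarse_le`; the
  existing `sq_le_of_blockUpper_maxLevel` has `2·s·m` and no conjugation).
* ★ `exists_large_irreducible_block` — **THE WILD CORE.**  For every affine nilpotent pencil `N` and affine `M`
  with `per_n = tr(N^d·M)` there are a constant `P` and levels `lvl < L ≤ m` such that every member of `W` is block
  upper triangular after `P` with IRREDUCIBLE diagonal block spaces (nilpotent linear subspaces of `M_{b_t}(ℂ)`
  acting irreducibly on `ℂ^{b_t}`), and for every `s ≥ 1` with `2(m/s + 1)·n + s·m < n²` SOME irreducible block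
  has size `b_t > s`.  With `m = μ·n` and `s = ⌊n/μ⌋ − o(n)`: an irreducible nilpotent constituent of size
  `≳ n²/m ≥ n/μ` — for `m` near Gerstenhaber's `√2·n` (✓ `two_mul_sq_le_of_dualUnipotentRepr`) at least HALF the
  width sits in ONE irreducible nilpotent block.
* `exists_large_irreducible_block_of_dualUnipotentRepr` — the same in the currency `DualUnipotentRepr n m` of the
  stub (normal form ✓ `exists_nilpotent_pencil_of_dualUnipotentRepr`).

So the stub is EQUIVALENT to its restriction to pencils carrying an irreducible nilpotent linear space of matrix
size `≥ n²/m·(1 − o(1))`; what remains open is the dimension theory of LARGE IRREDUCIBLE nilpotent spaces coupled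
to the permanent (Mathes–Omladič–Radjavi 1991, §5: their maximal dimension is an open question).

HONEST FRAMING: an unconditional structure theorem for the located open point of an ASIDE item; it closes no stub;
the crux, the rung 24318 and `VP ≠ VNP` are NOT proved.  No definitions, no named facts.

References: M. Gerstenhaber, Amer. J. Math. 80 (1958) 614–622, Thm. 1; B. Mathes, M. Omladič, H. Radjavi,
Linear Algebra Appl. 149 (1991) 215–225.
-/

-- single-conjunct layout `Summits/ValiantsHypothesis/ValiantsHypothesis`: the duplicated namespace
-- component is mandated by the tree.
set_option linter.dupNamespace false
set_option autoImplicit false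

noncomputable section

namespace Summit.ValiantsHypothesis.ValiantsHypothesis.Cruxes.TwoDimCoefficients.DimTwoCases

open MvPolynomial Matrix
open scoped BigOperators
open Literature.Computability.AlgebraicComplexity (perPoly)
open Summit.ValiantsHypothesis.ValiantsHypothesis.Theorems.GrenetZeon.RadicalSplit (linPart exists_topMap_linPart)
open Summit.ValiantsHypothesis.ValiantsHypothesis.Theorems.GrenetZeon.HeavyTopInvariantFlag (linPart_eq_coeff)
open Summit.ValiantsHypothesis.ValiantsHypothesis.Theorems.GrenetZeon.HeavyTopCompositionBound
  (pencil_blockUpper_of_forall_mem isNilpotent_block_of_mem exists_block_conj)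
open Literature.LinearAlgebra.Matrix.GerstenhaberNilpotentSubspace (finrank_le_choose_two)

variable {n m : ℕ}

/-! ### §0 Conjugating a polynomial pencil by a constant unit -/

/-- Evaluating a constant conjugate: `(P·N·Q)(x) = P·N(x)·Q` for constant `P`, `Q`. [folklore] -/
theorem map_eval_const_conj (P Q : Matrix (Fin m) (Fin m) ℂ) (N : AffMat n m) (x : Fin n × Fin n → ℂ) :
    ((P.map C * N * Q.map C : Matrix (Fin m) (Fin m) (MvPolynomial (Fin n × Fin n) ℂ)).map
        (MvPolynomial.eval x)) = P * N.map (MvPolynomial.eval x) * Q := by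
  rw [Matrix.map_mul, Matrix.map_mul, Matrix.map_map, Matrix.map_map]
  have hC : ((MvPolynomial.eval x : MvPolynomial (Fin n × Fin n) ℂ → ℂ) ∘
      (C : ℂ → MvPolynomial (Fin n × Fin n) ℂ)) = id := funext fun a => by simp
  rw [hC, Matrix.map_id, Matrix.map_id]

/-- The linear part of a constant conjugate is the conjugate of the linear part. [folklore] -/
theorem linPart_const_conj (P Q : Matrix (Fin m) (Fin m) ℂ) (N : AffMat n m) (v : Fin n × Fin n → ℂ) :
    linPart (P.map C * N * Q.map C) v = P * linPart N v * Q := by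
  simp only [Summit.ValiantsHypothesis.ValiantsHypothesis.Theorems.GrenetZeon.RadicalSplit.linPart]
  rw [map_eval_const_conj, map_eval_const_conj, Matrix.mul_sub, Matrix.sub_mul]

/-- The trace of power is conjugation invariant: `tr((P N P⁻¹)^d · (P M P⁻¹)) = tr(N^d · M)` for a constant unit
`P`. [folklore] -/
theorem trace_pow_mul_const_conj (P : (Matrix (Fin m) (Fin m) ℂ)ˣ) (N M : AffMat n m) (d : ℕ) :
    (((P : Matrix (Fin m) (Fin m) ℂ).map C * N * (↑P⁻¹ : Matrix (Fin m) (Fin m) ℂ).map C) ^ d *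
        ((P : Matrix (Fin m) (Fin m) ℂ).map C * M * (↑P⁻¹ : Matrix (Fin m) (Fin m) ℂ).map C) :
        Matrix (Fin m) (Fin m) (MvPolynomial (Fin n × Fin n) ℂ)).trace = (N ^ d * M).trace := by
  set PC : Matrix (Fin m) (Fin m) (MvPolynomial (Fin n × Fin n) ℂ) := (P : Matrix (Fin m) (Fin m) ℂ).map C
    with hPC
  set PiC : Matrix (Fin m) (Fin m) (MvPolynomial (Fin n × Fin n) ℂ) := (↑P⁻¹ : Matrix (Fin m) (Fin m) ℂ).map C
    with hPiC
  have hPP : PiC * PC = 1 := by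
    rw [hPC, hPiC, ← RingHom.mapMatrix_apply, ← RingHom.mapMatrix_apply, ← map_mul, Units.inv_mul, map_one]
  have hpow : ∀ e : ℕ, (PC * N * PiC) ^ e * PC = PC * N ^ e := by
    intro e
    induction e with
    | zero => rw [pow_zero, pow_zero, Matrix.one_mul, Matrix.mul_one]
    | succ e ih =>
        calc (PC * N * PiC) ^ (e + 1) * PC = (PC * N * PiC) ^ e * (PC * N * (PiC * PC)) := by
              rw [pow_succ]; simp only [Matrix.mul_assoc]
          _ = (PC * N * PiC) ^ e * PC * N := by rw [hPP, Matrix.mul_one, ← Matrix.mul_assoc]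
          _ = PC * N ^ (e + 1) := by rw [ih, pow_succ, Matrix.mul_assoc]
  calc ((PC * N * PiC) ^ d * (PC * M * PiC)).trace
      = ((PC * N * PiC) ^ d * PC * (M * PiC)).trace := by simp only [Matrix.mul_assoc]
    _ = (PC * N ^ d * (M * PiC)).trace := by rw [hpow]
    _ = (M * PiC * (PC * N ^ d)).trace := by rw [Matrix.trace_mul_comm]
    _ = (N ^ d * M).trace := by
        rw [Matrix.mul_assoc, ← Matrix.mul_assoc PiC, hPP, Matrix.one_mul, Matrix.trace_mul_comm]

/-! ### §1 The block rung, dimension form -/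

set_option maxHeartbeats 800000 in
/-- **Block rung, dimension form.**  `per_n = tr(N^d·M)` with `N`, `M` affine; `P·N·P⁻¹` block upper triangular
for `lvl` with `p` levels (`(P N P⁻¹)ᵢⱼ = 0` whenever `lvl i < lvl j`); the `t`-th diagonal block space of the
conjugated tops `P·N_lin(v)·P⁻¹` has dimension `≤ D t` ⟹ `n² ≤ 2·p·n + Σ_{t<p} D t`.
(Direction space `K = {v : all diagonal blocks of P·N_lin(v)·P⁻¹ vanish}`: `dim K ≤ 2pn` by level flatness
✓ `finrank_le_of_diagStill` applied to the conjugated pencils, `codim K ≤ Σ D t`, rank–nullity.) [folklore] -/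
theorem sq_le_of_blockDims {d : ℕ} (N M : AffMat n m) (hN : IsAffine N) (hM : IsAffine M)
    (hper : perPoly (Fin n) ℂ = (N ^ d * M).trace)
    (P : (Matrix (Fin m) (Fin m) ℂ)ˣ) (lvl : Fin m → ℕ) (p : ℕ) (hlvl : ∀ i, lvl i < p)
    (hblock : ∀ i j : Fin m, lvl i < lvl j →
      ((P : Matrix (Fin m) (Fin m) ℂ).map C * N * (↑P⁻¹ : Matrix (Fin m) (Fin m) ℂ).map C :
        Matrix (Fin m) (Fin m) (MvPolynomial (Fin n × Fin n) ℂ)) i j = 0)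
    (D : ℕ → ℕ)
    (hD : ∀ t : Fin p, ∃ (s : ℕ) (e : {i : Fin m // lvl i = (t : ℕ)} ≃ Fin s),
      Module.finrank ℂ (Submodule.span ℂ (Set.range fun v : Fin n × Fin n → ℂ =>
        Matrix.reindex e e (((P : Matrix (Fin m) (Fin m) ℂ) * linPart N v * (↑P⁻¹ : Matrix (Fin m) (Fin m) ℂ)).toBlock
          (fun i => lvl i = (t : ℕ)) (fun i => lvl i = (t : ℕ))))) ≤ D t) :
    n ^ 2 ≤ 2 * p * n + ∑ t ∈ Finset.range p, D t := by
  classical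
  -- the conjugated pencils
  set N' : AffMat n m := (P : Matrix (Fin m) (Fin m) ℂ).map C * N * (↑P⁻¹ : Matrix (Fin m) (Fin m) ℂ).map C
    with hN'
  set M' : AffMat n m := (P : Matrix (Fin m) (Fin m) ℂ).map C * M * (↑P⁻¹ : Matrix (Fin m) (Fin m) ℂ).map C
    with hM'
  have hN'aff : IsAffine N' := isAffine_conj _ _ N hN
  have hM'aff : IsAffine M' := isAffine_conj _ _ M hM
  have hper' : perPoly (Fin n) ℂ = (N' ^ d * M').trace := by
    rw [hper, hN', hM', trace_pow_mul_const_conj]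
  -- reversed levels (the 8062-side convention `N i j = 0` for `lev j < lev i`)
  let lev : Fin m → ℕ := fun i => p - 1 - lvl i
  have hup : ∀ i j : Fin m, lev j < lev i → N' i j = 0 := by
    intro i j hij
    have hi := hlvl i
    have hj := hlvl j
    exact hblock i j (by simp only [lev] at hij; omega)
  have hg : ∀ u : Fin m, lev u < p := fun u => by
    have hu := hlvl u
    simp only [lev]; omega
  -- the conjugated top map
  obtain ⟨T₀, hT₀⟩ := exists_topMap_linPart N hN
  let T : (Fin n × Fin n → ℂ) →ₗ[ℂ] Matrix (Fin m) (Fin m) ℂ :=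
    (LinearMap.mulRight ℂ (↑P⁻¹ : Matrix (Fin m) (Fin m) ℂ)) ∘ₗ
      (LinearMap.mulLeft ℂ (P : Matrix (Fin m) (Fin m) ℂ)) ∘ₗ T₀
  have hT : ∀ v, T v = (P : Matrix (Fin m) (Fin m) ℂ) * linPart N v * (↑P⁻¹ : Matrix (Fin m) (Fin m) ℂ) := by
    intro v
    simp only [T, LinearMap.coe_comp, Function.comp_apply, LinearMap.mulLeft_apply, LinearMap.mulRight_apply, hT₀]
  have hTlin : ∀ v, T v = linPart N' v := by
    intro v; rw [hT, hN', linPart_const_conj]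
  -- the block maps (in the re-indexings supplied by `hD`)
  choose sz e hsz using hD
  let blk : ∀ t : Fin p, Matrix (Fin m) (Fin m) ℂ →ₗ[ℂ] Matrix (Fin (sz t)) (Fin (sz t)) ℂ := fun t =>
    (Matrix.reindexAlgEquiv ℂ ℂ (e t)).toLinearEquiv.toLinearMap ∘ₗ
      { toFun := fun A => A.toBlock (fun i => lvl i = (t : ℕ)) (fun i => lvl i = (t : ℕ))
        map_add' := fun A B => rfl
        map_smul' := fun c A => rfl }
  have hblk : ∀ (t : Fin p) (A : Matrix (Fin m) (Fin m) ℂ),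
      blk t A = Matrix.reindexAlgEquiv ℂ ℂ (e t) (A.toBlock (fun i => lvl i = (t : ℕ)) (fun i => lvl i = (t : ℕ))) :=
    fun t A => rfl
  let Φ : (Fin n × Fin n → ℂ) →ₗ[ℂ] (∀ t : Fin p, Matrix (Fin (sz t)) (Fin (sz t)) ℂ) :=
    LinearMap.pi fun t => blk t ∘ₗ T
  have hΦ : ∀ v t, Φ v t = blk t (T v) := fun v t => rfl
  -- the block spaces are the spans of the statement
  have hDt : ∀ t : Fin p, Module.finrank ℂ (LinearMap.range (blk t ∘ₗ T)) ≤ D t := by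
    intro t
    have hrg : LinearMap.range (blk t ∘ₗ T) = Submodule.span ℂ (Set.range fun v : Fin n × Fin n → ℂ =>
        Matrix.reindex (e t) (e t) (((P : Matrix (Fin m) (Fin m) ℂ) * linPart N v * (↑P⁻¹ : Matrix (Fin m) (Fin m) ℂ)).toBlock
          (fun i => lvl i = (t : ℕ)) (fun i => lvl i = (t : ℕ)))) := by
      rw [← Submodule.span_eq (LinearMap.range _), LinearMap.coe_range]
      congr 1
      ext A
      simp only [Set.mem_range, LinearMap.comp_apply, hblk, Matrix.coe_reindexAlgEquiv, hT]
    rw [hrg]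
    exact hsz t
  -- `codim K ≤ Σ D t`: the range of `Φ` embeds into the product of the block spaces
  have hrange : Module.finrank ℂ (LinearMap.range Φ) ≤ ∑ t : Fin p, D t := by
    let ι : LinearMap.range Φ →ₗ[ℂ] (∀ t : Fin p, LinearMap.range (blk t ∘ₗ T)) :=
      LinearMap.pi fun t =>
        { toFun := fun x => ⟨x.1 t, by
            obtain ⟨v, hv⟩ := LinearMap.mem_range.1 x.2
            exact LinearMap.mem_range.2 ⟨v, by rw [← hv]; rfl⟩⟩
          map_add' := fun x y => rfl
          map_smul' := fun c x => rfl }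
    have hι : Function.Injective ι := by
      intro x y hxy
      apply Subtype.ext
      funext t
      have := congr_arg (fun f => ((f t : LinearMap.range (blk t ∘ₗ T)) : Matrix (Fin (sz t)) (Fin (sz t)) ℂ))
        hxy
      exact this
    calc Module.finrank ℂ (LinearMap.range Φ)
        ≤ Module.finrank ℂ (∀ t : Fin p, LinearMap.range (blk t ∘ₗ T)) :=
          LinearMap.finrank_le_finrank_of_injective hι
      _ = ∑ t : Fin p, Module.finrank ℂ (LinearMap.range (blk t ∘ₗ T)) := Module.finrank_pi_fintype ℂ
      _ ≤ ∑ t : Fin p, D t := Finset.sum_le_sum fun t _ => hDt t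
  have hsum : ∑ t : Fin p, D t = ∑ t ∈ Finset.range p, D t := Fin.sum_univ_eq_sum_range (fun t => D t) p
  -- `dim K ≤ 2pn`: level flatness for the conjugated pencils
  have hker : Module.finrank ℂ (LinearMap.ker Φ) ≤ 2 * p * n := by
    refine finrank_le_of_diagStill N' M' lev (LinearMap.ker Φ) hN'aff hM'aff hup hg hper' ?_
    intro v hv i j hij
    have hi := hlvl i
    have hj := hlvl j
    have he : lvl i = lvl j := by simp only [lev] at hij; omega
    have hv0 : Φ v = 0 := LinearMap.mem_ker.mp hv
    have hb : blk ⟨lvl i, hlvl i⟩ (T v) = 0 := by rw [← hΦ, hv0]; rfl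
    rw [hblk, map_eq_zero_iff _ (Matrix.reindexAlgEquiv ℂ ℂ _).injective] at hb
    have h0 := congr_fun (congr_fun hb ⟨i, rfl⟩) ⟨j, he.symm⟩
    rw [Matrix.toBlock_apply, Matrix.zero_apply, hTlin, linPart_eq_coeff N' hN'aff v, Matrix.of_apply] at h0
    exact h0
  -- rank–nullity
  have h1 := LinearMap.finrank_range_add_finrank_ker Φ
  have h3 : Module.finrank ℂ (Fin n × Fin n → ℂ) = n * n := by
    rw [Module.finrank_fintype_fun_eq_card, Fintype.card_prod, Fintype.card_fin]
  have h4 : n ^ 2 = n * n := sq n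
  rw [← hsum]
  omega

/-! ### §2 Nilpotent pencils: Gerstenhaber inside the blocks -/

/-- **Gerstenhaber inside a diagonal block.**  For an affine NILPOTENT pencil (`N^m = 0`) whose nilpotent space
`W = ℂ·N(0) + N_lin(ℂ^{n×n})` is block upper triangular after `P`, the `t`-th diagonal block space of the conjugated
tops (size `s`) consists of nilpotent matrices, so has dimension `≤ C(s, 2)`.
[cite: Gerstenhaber1958, Thm. 1 — via ✓ `finrank_le_choose_two`] -/
theorem finrank_blockSpan_le_choose_two (N : AffMat n m) (hN : IsAffine N) (hnil : N ^ m = 0)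
    (T : (Fin n × Fin n → ℂ) →ₗ[ℂ] Matrix (Fin m) (Fin m) ℂ) (hT : ∀ v, T v = linPart N v)
    (P : (Matrix (Fin m) (Fin m) ℂ)ˣ) (lvl : Fin m → ℕ)
    (hPW : ∀ A ∈ (ℂ ∙ N.map (MvPolynomial.eval 0)) ⊔ LinearMap.range T, ∀ i j : Fin m, lvl i < lvl j →
      ((P : Matrix (Fin m) (Fin m) ℂ) * A * (↑P⁻¹ : Matrix (Fin m) (Fin m) ℂ)) i j = 0)
    (t : ℕ) {s : ℕ} (e : {i : Fin m // lvl i = t} ≃ Fin s) :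
    Module.finrank ℂ (Submodule.span ℂ (Set.range fun v : Fin n × Fin n → ℂ =>
        Matrix.reindex e e (((P : Matrix (Fin m) (Fin m) ℂ) * linPart N v * (↑P⁻¹ : Matrix (Fin m) (Fin m) ℂ)).toBlock
          (fun i => lvl i = t) (fun i => lvl i = t)))) ≤ s.choose 2 := by
  classical
  let blkW : Matrix (Fin m) (Fin m) ℂ →ₗ[ℂ] Matrix (Fin s) (Fin s) ℂ :=
    { toFun := fun A => Matrix.reindex e e
        ((((P : Matrix (Fin m) (Fin m) ℂ) * A * (↑P⁻¹ : Matrix (Fin m) (Fin m) ℂ)).toBlock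
          (fun i => lvl i = t) (fun i => lvl i = t)))
      map_add' := fun A B => by
        ext a c
        simp only [Matrix.reindex_apply, Matrix.submatrix_apply, Matrix.toBlock_apply, Matrix.add_apply,
          Matrix.mul_add, Matrix.add_mul]
      map_smul' := fun c A => by
        ext a a'
        simp only [Matrix.reindex_apply, Matrix.submatrix_apply, Matrix.toBlock_apply, Matrix.smul_apply,
          Matrix.mul_smul, Matrix.smul_mul, RingHom.id_apply] }
  have hVnil : ∀ B ∈ ((ℂ ∙ N.map (MvPolynomial.eval 0)) ⊔ LinearMap.range T).map blkW, IsNilpotent B := by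
    intro B hB
    obtain ⟨A, hA, rfl⟩ := Submodule.mem_map.1 hB
    exact isNilpotent_block_of_mem N hN hnil T hT P lvl A hA (hPW A hA) t e
  refine (Submodule.finrank_mono ?_).trans (finrank_le_choose_two s _ hVnil)
  rw [Submodule.span_le]
  rintro _ ⟨v, rfl⟩
  refine ⟨linPart N v, ?_, rfl⟩
  rw [SetLike.mem_coe, ← hT]
  exact Submodule.mem_sup_right (LinearMap.mem_range_self T v)

/-- The number of members of level `t`. -/
theorem card_level_subtype (lvl : Fin m → ℕ) (t : ℕ) :
    Fintype.card {i : Fin m // lvl i = t} = (Finset.univ.filter fun i => lvl i = t).card := by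
  classical
  exact Fintype.card_subtype _

/-- **Block rung for nilpotent pencils.**  `per_n = tr(N^d·M)` (`N`, `M` affine, `N^m = 0`) and the nilpotent
space `W = ℂ·N(0) + N_lin(ℂ^{n×n})` block upper triangular after `P` for `lvl` with `p` levels
⟹ `n² ≤ 2·p·n + Σ_{t<p} C(b_t, 2)`, `b_t = #{i : lvl i = t}`. [folklore + Gerstenhaber 1958 via the tree] -/
theorem sq_le_of_blockLevels_nil {d : ℕ} (N M : AffMat n m) (hN : IsAffine N) (hM : IsAffine M)
    (hnil : N ^ m = 0) (hper : perPoly (Fin n) ℂ = (N ^ d * M).trace)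
    (T : (Fin n × Fin n → ℂ) →ₗ[ℂ] Matrix (Fin m) (Fin m) ℂ) (hT : ∀ v, T v = linPart N v)
    (P : (Matrix (Fin m) (Fin m) ℂ)ˣ) (lvl : Fin m → ℕ) (p : ℕ) (hlvl : ∀ i, lvl i < p)
    (hPW : ∀ A ∈ (ℂ ∙ N.map (MvPolynomial.eval 0)) ⊔ LinearMap.range T, ∀ i j : Fin m, lvl i < lvl j →
      ((P : Matrix (Fin m) (Fin m) ℂ) * A * (↑P⁻¹ : Matrix (Fin m) (Fin m) ℂ)) i j = 0) :
    n ^ 2 ≤ 2 * p * n + ∑ t ∈ Finset.range p, ((Finset.univ.filter fun i => lvl i = t).card).choose 2 := by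
  classical
  refine sq_le_of_blockDims N M hN hM hper P lvl p hlvl (pencil_blockUpper_of_forall_mem N T hT P lvl hPW)
    (fun t => ((Finset.univ.filter fun i => lvl i = t).card).choose 2) fun t => ?_
  refine ⟨(Finset.univ.filter fun i => lvl i = (t : ℕ)).card,
    Fintype.equivFinOfCardEq (card_level_subtype lvl t), ?_⟩
  exact finrank_blockSpan_le_choose_two N hN hnil T hT P lvl hPW t _

/-- **Coarse form.**  Same setting, every level with `≤ s` members (`s ≥ 1`; any number `L` of levels)
⟹ `n² ≤ 2(m/s + 1)·n + s·m`: coarsen to the levels `#{k : lvl k < lvl i}/s` (✓ `KrylovSeed.coarse_lt_imp`,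
`coarse_lt`), fewer than `m/s + 1` of them, whose Gerstenhaber sum is `≤ s·m` (✓ `KrylovSeed.sum_choose_coarse_le`).
[folklore + Gerstenhaber 1958 via the tree] -/
theorem sq_le_of_smallLevels_nil {d : ℕ} (N M : AffMat n m) (hN : IsAffine N) (hM : IsAffine M)
    (hnil : N ^ m = 0) (hper : perPoly (Fin n) ℂ = (N ^ d * M).trace)
    (T : (Fin n × Fin n → ℂ) →ₗ[ℂ] Matrix (Fin m) (Fin m) ℂ) (hT : ∀ v, T v = linPart N v)
    (P : (Matrix (Fin m) (Fin m) ℂ)ˣ) (lvl : Fin m → ℕ) (L : ℕ) (hlvl : ∀ i, lvl i < L)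
    (hPW : ∀ A ∈ (ℂ ∙ N.map (MvPolynomial.eval 0)) ⊔ LinearMap.range T, ∀ i j : Fin m, lvl i < lvl j →
      ((P : Matrix (Fin m) (Fin m) ℂ) * A * (↑P⁻¹ : Matrix (Fin m) (Fin m) ℂ)) i j = 0)
    (s : ℕ) (hs : 1 ≤ s) (hsmall : ∀ t, t < L → (Finset.univ.filter fun i => lvl i = t).card ≤ s) :
    n ^ 2 ≤ 2 * (m / s + 1) * n + s * m := by
  classical
  let lvl' : Fin m → ℕ := fun i => (Finset.univ.filter fun k => lvl k < lvl i).card / s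
  have hlvl' : ∀ i, lvl' i < m / s + 1 := fun i =>
    Summit.ValiantsHypothesis.ValiantsHypothesis.Theorems.GrenetZeon.KrylovSeed.coarse_lt lvl s i
  have hPW' : ∀ A ∈ (ℂ ∙ N.map (MvPolynomial.eval 0)) ⊔ LinearMap.range T, ∀ i j : Fin m, lvl' i < lvl' j →
      ((P : Matrix (Fin m) (Fin m) ℂ) * A * (↑P⁻¹ : Matrix (Fin m) (Fin m) ℂ)) i j = 0 :=
    fun A hA i j hij => hPW A hA i j
      (Summit.ValiantsHypothesis.ValiantsHypothesis.Theorems.GrenetZeon.KrylovSeed.coarse_lt_imp lvl s hij)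
  have h := sq_le_of_blockLevels_nil N M hN hM hnil hper T hT P lvl' (m / s + 1) hlvl' hPW'
  have hsum := Summit.ValiantsHypothesis.ValiantsHypothesis.Theorems.GrenetZeon.KrylovSeed.sum_choose_coarse_le
    lvl s hs hlvl hsmall
  exact h.trans (Nat.add_le_add_left hsum _)

/-! ### §3 The wild core -/

/-- ★ **THE WILD CORE (unconditional).**  Let `per_n = tr(N^d·M)` with `N`, `M` affine `m × m` pencils and `N`
nilpotent (`N^m = 0`).  Then the nilpotent linear space `W = ℂ·N(0) + N_lin(ℂ^{n×n})` admits a constant change of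
basis `P` and levels `lvl < L ≤ m` (all non-empty) such that every member of `W` is block upper triangular after
`P` (`(P A P⁻¹)ᵢⱼ = 0` for `lvl i < lvl j`), every diagonal block space acts IRREDUCIBLY (Jordan–Hölder, ✓
`exists_block_conj`), the block rung `n² ≤ 2·L·n + Σ_{t<L} C(b_t,2)` holds, and for every `s ≥ 1` with
`2(m/s + 1)·n + s·m < n²` SOME irreducible block has MORE than `s` members.  (With `s ≈ n²/m`: an irreducible
nilpotent constituent of matrix size `≳ n²/m`.) [folklore + Gerstenhaber 1958 via the tree] -/
theorem exists_large_irreducible_block {d : ℕ} (N M : AffMat n m) (hN : IsAffine N) (hM : IsAffine M)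
    (hnil : N ^ m = 0) (hper : perPoly (Fin n) ℂ = (N ^ d * M).trace) :
    ∃ (T : (Fin n × Fin n → ℂ) →ₗ[ℂ] Matrix (Fin m) (Fin m) ℂ), (∀ v, T v = linPart N v) ∧
    ∃ (P : (Matrix (Fin m) (Fin m) ℂ)ˣ) (L : ℕ) (lvl : Fin m → ℕ),
      (∀ i, lvl i < L) ∧ L ≤ m ∧ (∀ t, t < L → 0 < (Finset.univ.filter (fun i => lvl i = t)).card) ∧
      (∀ A ∈ (ℂ ∙ N.map (MvPolynomial.eval 0)) ⊔ LinearMap.range T, ∀ i j : Fin m, lvl i < lvl j →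
        ((P : Matrix (Fin m) (Fin m) ℂ) * A * (↑P⁻¹ : Matrix (Fin m) (Fin m) ℂ)) i j = 0) ∧
      (∀ t, t < L → ∀ (s : ℕ) (e : {i : Fin m // lvl i = t} ≃ Fin s) (U : Submodule ℂ (Fin s → ℂ)),
        (∀ A ∈ (ℂ ∙ N.map (MvPolynomial.eval 0)) ⊔ LinearMap.range T, ∀ x ∈ U,
          (Matrix.reindex e e (((P : Matrix (Fin m) (Fin m) ℂ) * A * (↑P⁻¹ : Matrix (Fin m) (Fin m) ℂ)).toBlock
            (fun i => lvl i = t) (fun i => lvl i = t))) *ᵥ x ∈ U) →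
        U = ⊥ ∨ U = ⊤) ∧
      n ^ 2 ≤ 2 * L * n + ∑ t ∈ Finset.range L, ((Finset.univ.filter fun i => lvl i = t).card).choose 2 ∧
      (∀ s : ℕ, 1 ≤ s → 2 * (m / s + 1) * n + s * m < n ^ 2 →
        ∃ t, t < L ∧ s < (Finset.univ.filter fun i => lvl i = t).card) := by
  classical
  obtain ⟨T, hT⟩ := exists_topMap_linPart N hN
  obtain ⟨P, L, lvl, hlvl, hLm, hne, hblock, hirr⟩ :=
    exists_block_conj (((ℂ ∙ N.map (MvPolynomial.eval 0)) ⊔ LinearMap.range T :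
      Submodule ℂ (Matrix (Fin m) (Fin m) ℂ)) : Set (Matrix (Fin m) (Fin m) ℂ))
  have hPW : ∀ A ∈ (ℂ ∙ N.map (MvPolynomial.eval 0)) ⊔ LinearMap.range T, ∀ i j : Fin m, lvl i < lvl j →
      ((P : Matrix (Fin m) (Fin m) ℂ) * A * (↑P⁻¹ : Matrix (Fin m) (Fin m) ℂ)) i j = 0 :=
    fun A hA => hblock A hA
  refine ⟨T, hT, P, L, lvl, hlvl, hLm, hne, hPW, fun t ht s e U hU => hirr t ht s e U hU,
    sq_le_of_blockLevels_nil N M hN hM hnil hper T hT P lvl L hlvl hPW, fun s hs hlt => ?_⟩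
  by_contra hcon
  have hsmall : ∀ t, t < L → (Finset.univ.filter fun i => lvl i = t).card ≤ s :=
    fun t ht => le_of_not_gt fun hgt => hcon ⟨t, ht, hgt⟩
  have h := sq_le_of_smallLevels_nil N M hN hM hnil hper T hT P lvl L hlvl hPW s hs hsmall
  omega

/-- **The wild core in the currency of the stub.**  A unipotent-dual representation of `per_n` of width `m`
(`DualUnipotentRepr n m`, `n ≥ 1`) has a nilpotent-pencil normal form `per_n = tr(N^{n−1}·M)` (✓
`exists_nilpotent_pencil_of_dualUnipotentRepr`) whose nilpotent space, in Jordan–Hölder block form, has for every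
`s ≥ 1` with `2(m/s + 1)·n + s·m < n²` an IRREDUCIBLE diagonal block with more than `s` members.
[folklore + Gerstenhaber 1958 via the tree] -/
theorem exists_large_irreducible_block_of_dualUnipotentRepr (hn : 1 ≤ n) (h : DualUnipotentRepr n m) :
    ∃ N M : AffMat n m, IsAffine N ∧ IsAffine M ∧ N ^ m = 0 ∧
      perPoly (Fin n) ℂ = (N ^ (n - 1) * M).trace ∧
    ∃ (T : (Fin n × Fin n → ℂ) →ₗ[ℂ] Matrix (Fin m) (Fin m) ℂ), (∀ v, T v = linPart N v) ∧
    ∃ (P : (Matrix (Fin m) (Fin m) ℂ)ˣ) (L : ℕ) (lvl : Fin m → ℕ),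
      (∀ i, lvl i < L) ∧ L ≤ m ∧ (∀ t, t < L → 0 < (Finset.univ.filter (fun i => lvl i = t)).card) ∧
      (∀ A ∈ (ℂ ∙ N.map (MvPolynomial.eval 0)) ⊔ LinearMap.range T, ∀ i j : Fin m, lvl i < lvl j →
        ((P : Matrix (Fin m) (Fin m) ℂ) * A * (↑P⁻¹ : Matrix (Fin m) (Fin m) ℂ)) i j = 0) ∧
      (∀ t, t < L → ∀ (s : ℕ) (e : {i : Fin m // lvl i = t} ≃ Fin s) (U : Submodule ℂ (Fin s → ℂ)),
        (∀ A ∈ (ℂ ∙ N.map (MvPolynomial.eval 0)) ⊔ LinearMap.range T, ∀ x ∈ U,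
          (Matrix.reindex e e (((P : Matrix (Fin m) (Fin m) ℂ) * A * (↑P⁻¹ : Matrix (Fin m) (Fin m) ℂ)).toBlock
            (fun i => lvl i = t) (fun i => lvl i = t))) *ᵥ x ∈ U) →
        U = ⊥ ∨ U = ⊤) ∧
      n ^ 2 ≤ 2 * L * n + ∑ t ∈ Finset.range L, ((Finset.univ.filter fun i => lvl i = t).card).choose 2 ∧
      (∀ s : ℕ, 1 ≤ s → 2 * (m / s + 1) * n + s * m < n ^ 2 →
        ∃ t, t < L ∧ s < (Finset.univ.filter fun i => lvl i = t).card) := by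
  obtain ⟨N, M, hN1, hM1, hnil, hper⟩ := exists_nilpotent_pencil_of_dualUnipotentRepr hn h
  have hN : IsAffine N := fun i j => (hN1 i j).totalDegree_le
  have hM : IsAffine M := fun i j => (hM1 i j).totalDegree_le
  exact ⟨N, M, hN, hM, hnil, hper, exists_large_irreducible_block N M hN hM hnil hper⟩

end Summit.ValiantsHypothesis.ValiantsHypothesis.Cruxes.TwoDimCoefficients.DimTwoCases

end
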